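import Summits.QuantumFields.YangMills.Theorems.CurvatureSandwichBound.Negative.RandomConstField
import Summits.QuantumFields.YangMills.Theorems.CurvatureSandwichBound.Negative.SupNormOnlyFalse

/-!
# `CurvatureSandwichBound` (Σ) — negative-side support VIII: the CONVEXITY BARRIER — the rows fail for the random
constant field; clustering / the gap are load-bearing for the model-blind core

Support file for crux `stmt-QuantumFields-18372` (lead prover c2, line `Sketch`).  Tree objects only; nothing is posited.
Continues support file VII (`RandomConstField.lean`: the random constant field `𝔖ₙ(F) = n! ∫F` meets every
mixture-stable clause of the model-blind core — E0, hermiticity, E0', E2 in every frame, E3, translations, hypercubic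
invariance, planar cone, soft kernel).

* `not_sandwichBound_factField`, `not_sandwichRows_factField`: the rows FAIL for it — with `u = v = 1`, the windowed
  insertion `f₁ = g ⊗ hh₁` of support file III and the chains `Wₙ = f₁ ⊗ T₃(f₁ ⊗ T₃(⋯))` of degree `n`,
  `‖Ψ_{f₁ ⊗ T₃Wₙ}‖² / ‖Ψ_{Wₙ}‖² = (2n+2)(2n+1) |∫f₁|² → ∞`;
* `SandwichModelBlindConvex`, `sandwichModelBlind_of_convex`, `not_sandwichModelBlindConvex`: the model-blind core with
  its two non-convex clauses (E4, the continuum gap) deleted is FALSE.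

MEANING for the crux: a model-blind proof of Σ must use E4 or the mass gap (uniqueness of the vacuum) in an essential,
non-convex way; reflection positivity in the sixteen mirrors / Schwarz / planar-cone / soft-kernel manipulations — all
stable under mixtures of families — can never reach the rows (they hold in each `constField κ` with constant `|κ|/2`,
unbounded over the mixture).  This sharpens the standing disprover's §3e ("E4, gap: no known role in the `e₀` row").
-/

noncomputable section

namespace Summit.QuantumFields.YangMills.Theorems.CurvatureSandwichBound.Negative

open scoped BigOperators SchwartzMap ComplexConjugate InnerProductSpace ENNReal
open MeasureTheory Filter Topology Complex
open Literature.MathematicalPhysics.QuantumLattice Literature.MathematicalPhysics.AQFT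
  Literature.MathematicalPhysics.QuantumFieldTheory
open Summit.QuantumFields.YangMills.Theorems.NPointIsotropy.Negative (E4)
open Summit.QuantumFields.YangMills.Theorems.CurvatureBoostCovariance.Negative
  (OSPackage Translations Hypercubic EightFrameRP PlanarCone)
open Summit.QuantumFields.YangMills.Theorems.SoftKernelBoostCovariance.Negative (SoftKernel)
open Summit.QuantumFields.YangMills.Theorems.DiagonalMirrorRPR.Negative
  (integ integ_apply integral_linActMulti integral_appendTensor integral_osAdjoint)

variable {n m : ℕ}

/-! ## §5 The rows FAIL for the random constant field -/

namespace FactWitness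

open SupWitness

/-- The sandwich at `u = v = 1`: `X W = f₁ ⊗ T_{3e₀} W` with the insertion `f₁ = g ⊗ hh₁` of support file III. -/
def X (W : 𝓢((Fin n → E4), ℂ)) : 𝓢((Fin (1 + n) → E4), ℂ) :=
  SchwartzMap.appendTensor (f₁ one_pos) (translateMulti (((2 : ℝ) * 1 + 1) • EuclideanSpace.single 0 1) W)

/-- The insertion's times lie in `[1, 2]`. -/
theorem tsupport_f₁_subset : tsupport ((f₁ one_pos : 𝓢((Fin 1 → E4), ℂ)) : (Fin 1 → E4) → ℂ) ⊆
    {y | 1 ≤ y 0 0 ∧ y 0 0 ≤ 2 * 1} := by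
  refine closure_minimal (fun y hy => ?_) ?_
  · exact g_window _ (left_ne_zero_of_mul (Function.mem_support.1 hy))
  · have hcont : Continuous fun x : Fin 1 → E4 => x 0 0 :=
      (EuclideanSpace.proj (0 : Fin 4)).continuous.comp (continuous_apply 0)
    exact (isClosed_le continuous_const hcont).inter (isClosed_le hcont continuous_const)

/-- **The sandwich step preserves time-ordering**: head times in `[1,2]`, tail times `> 3`. -/
theorem isTimeOrdered_X {W : 𝓢((Fin n → E4), ℂ)} (hW : IsTimeOrdered W) : IsTimeOrdered (X W) := by
  intro x hx
  obtain ⟨hA, hB⟩ := OSReconstructionNoE1.tsupport_appendTensor_subset _ _ hx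
  have hB' := hW (OSReconstructionNoE1.tsupport_translateMulti_subset _ _ hB)
  have ha0 : ((((2 : ℝ) * 1 + 1) • EuclideanSpace.single 0 1 : E4)) 0 = 3 := by simp; norm_num
  simp only [Set.mem_setOf_eq, PiLp.sub_apply, ha0] at hB'
  obtain ⟨h1, h2⟩ := tsupport_f₁_subset hA
  have hcast : ∀ i : Fin 1, Fin.castAdd n i = Fin.castAdd n 0 := fun i => congrArg _ (Subsingleton.elim i 0)
  have htail : ∀ j : Fin n, 3 < x (Fin.natAdd 1 j) 0 := fun j => by have := hB'.1 j; linarith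
  refine ⟨fun i => ?_, fun i j hij => ?_⟩
  · induction i using Fin.addCases with
    | left i => rw [hcast i]; linarith
    | right j => linarith [htail j]
  · induction i using Fin.addCases with
    | left i =>
      induction j using Fin.addCases with
      | left j =>
        exfalso
        rw [hcast i, hcast j] at hij
        exact lt_irrefl _ hij
      | right j =>
        show x (Fin.castAdd n i) 0 < x (Fin.natAdd 1 j) 0
        rw [hcast i]
        linarith [htail j]
    | right i =>
      induction j using Fin.addCases with
      | left j =>
        exfalso
        have hj := j.isLt
        rw [Fin.lt_def, Fin.val_natAdd, Fin.val_castAdd] at hij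
        omega
      | right j =>
        have hij' : i < j := by
          rw [Fin.lt_def, Fin.val_natAdd, Fin.val_natAdd] at hij
          rw [Fin.lt_def]
          omega
        have := hB'.2 hij'
        simp only at this
        show x (Fin.natAdd 1 i) 0 < x (Fin.natAdd 1 j) 0
        linarith

/-- `∫ X W = ∫ f₁ · ∫ W`. -/
theorem integral_X (W : 𝓢((Fin n → E4), ℂ)) : ∫ x, X W x = (∫ x, f₁ one_pos x) * ∫ x, W x := by
  rw [X, integral_appendTensor (isAppendTensorOf_appendTensor _ _), integral_translateMulti]

/-- `∫ f₁ ≠ 0` (a product of integrals of bumps). -/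
theorem integral_f₁_ne_zero : (∫ x, f₁ one_pos x) ≠ 0 := by
  rw [integral_f₁, integral_g, integral_hh one_pos, ← Complex.ofReal_mul, Complex.ofReal_ne_zero]
  have h1 : 0 < ∫ s, bt s := bt.integral_pos
  have h2 : 0 < ∫ t, bx t := bx.integral_pos
  have h3 : 0 < ∫ s, bL one_pos s := (bL one_pos).integral_pos
  positivity

/-- **Chains of every degree**: time-ordered `W` of degree `n` with `X W` time-ordered and `∫ W ≠ 0`. -/
theorem exists_chain : ∀ n : ℕ, ∃ W : 𝓢((Fin n → E4), ℂ), IsTimeOrdered W ∧ IsTimeOrdered (X W) ∧ (∫ x, W x) ≠ 0 := by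
  intro n
  induction n with
  | zero => exact ⟨W0, isTimeOrdered_W0, isTimeOrdered_X isTimeOrdered_W0, by rw [integral_W0]; exact one_ne_zero⟩
  | succ n ih =>
    obtain ⟨W, hW, hXW, hI⟩ := ih
    have h : ∃ W' : 𝓢((Fin (1 + n) → E4), ℂ), IsTimeOrdered W' ∧ IsTimeOrdered (X W') ∧ (∫ x, W' x) ≠ 0 :=
      ⟨X W, hXW, isTimeOrdered_X hXW, by rw [integral_X]; exact mul_ne_zero integral_f₁_ne_zero hI⟩
    rwa [Nat.add_comm] at h

end FactWitness

open SupWitness FactWitness in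
/-- **Theorem (the rows fail for the random constant field).**  For ITS `e₀`-reconstruction, no `μ` and no `C` give the
sandwich bound: at `u = v = 1`, `f₁ = g ⊗ hh₁` (`Mg = ∫|g|`, `Mh = ∫|hh₁|`, `Mh' = 1`) and the chain `Wₙ` of degree `n`,
`‖Ψ_{f₁ ⊗ T₃ Wₙ}‖² = (2n+2)! |∫f₁|² |∫Wₙ|²` against `(2C·Mg·(Mh+1))² (2n)! |∫Wₙ|²`, i.e. `(2n+2)(2n+1)|∫f₁|² ≤ K²` for
all `n` — absurd. -/
theorem not_sandwichBound_factField (μ C : ℝ) : ¬ SandwichBound factField osReconstruction_factField μ C := by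
  intro hS
  set h := osReconstruction_factField
  set A : ℝ := ‖∫ x, f₁ one_pos x‖ ^ 2 with hAdef
  have hA : 0 < A := by positivity [norm_pos_iff.2 integral_f₁_ne_zero]
  set K : ℝ := C * (∫ p, ‖g p‖) * ((∫ q, ‖hh one_pos q‖) + 1) * ((1 : ℝ) ^ (-μ) + (1 : ℝ) ^ (-μ)) with hKdef
  -- the bound on the chain of degree `n` gives `(n + 1) A ≤ K²`
  have hstep : ∀ n : ℕ, ((n : ℝ) + 1) * A ≤ K ^ 2 := by
    intro n
    obtain ⟨W, hW, hXW, hI⟩ := exists_chain n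
    have key := hS 1 1 one_pos one_pos le_rfl le_rfl (f₁ one_pos) g (hh one_pos) (∫ p, ‖g p‖) (∫ q, ‖hh one_pos q‖)
      1 (f₁_apply one_pos) g_window integrable_g le_rfl (integrable_hh one_pos) le_rfl (norm_hh_le one_pos) n W hW hXW
    -- square both sides and insert the norms
    have key2 := pow_le_pow_left₀ (norm_nonneg _) key 2
    rw [mul_pow, norm_fieldVec_factField_sq, norm_fieldVec_factField_sq] at key2
    have hIX : (∫ x, (SchwartzMap.appendTensor (f₁ one_pos)
        (translateMulti (((2 : ℝ) * 1 + 1) • EuclideanSpace.single 0 1) W)) x) = (∫ x, f₁ one_pos x) * ∫ x, W x :=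
      integral_X W
    rw [hIX, norm_mul, mul_pow, ← hAdef, ← hKdef] at key2
    -- key2 : ((1+n)+(1+n))! * (‖∫f₁‖² * ‖∫W‖²) ≤ K ^ 2 * ((n+n)! * ‖∫W‖²)
    have hW2 : 0 < ‖∫ x, W x‖ ^ 2 := by positivity [norm_pos_iff.2 hI]
    have hfact : (((1 + n) + (1 + n)).factorial : ℝ) = ((n + n + 2 : ℕ) : ℝ) * ((n + n + 1 : ℕ) : ℝ) * (n + n).factorial := by
      rw [show (1 + n) + (1 + n) = (n + n + 1) + 1 by ring, Nat.factorial_succ, Nat.factorial_succ]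
      push_cast; ring
    rw [hfact] at key2
    have hnn : (0 : ℝ) < (n + n).factorial := Nat.cast_pos.2 (Nat.factorial_pos _)
    -- divide by `(n+n)! ‖∫W‖² > 0`
    have key3 : ((n + n + 2 : ℕ) : ℝ) * ((n + n + 1 : ℕ) : ℝ) * A ≤ K ^ 2 := by
      have := key2
      have e1 : ((n + n + 2 : ℕ) : ℝ) * ((n + n + 1 : ℕ) : ℝ) * ((n + n).factorial : ℝ) * (A * ‖∫ x, W x‖ ^ 2) =
          (((n + n + 2 : ℕ) : ℝ) * ((n + n + 1 : ℕ) : ℝ) * A) * (((n + n).factorial : ℝ) * ‖∫ x, W x‖ ^ 2) := by ring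
      rw [e1] at this
      exact le_of_mul_le_mul_right this (mul_pos hnn hW2)
    have hmono : ((n : ℝ) + 1) ≤ ((n + n + 2 : ℕ) : ℝ) * ((n + n + 1 : ℕ) : ℝ) := by
      push_cast; nlinarith [(Nat.cast_nonneg n : (0 : ℝ) ≤ n)]
    calc ((n : ℝ) + 1) * A ≤ ((n + n + 2 : ℕ) : ℝ) * ((n + n + 1 : ℕ) : ℝ) * A :=
          mul_le_mul_of_nonneg_right hmono hA.le
      _ ≤ K ^ 2 := key3
  -- Archimedes
  obtain ⟨n, hn⟩ := exists_nat_gt (K ^ 2 / A)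
  have h1 := hstep n
  rw [div_lt_iff₀ hA] at hn
  nlinarith

/-- **Corollary: `SandwichRows factField` is false.** -/
theorem not_sandwichRows_factField : ¬ SandwichRows factField := fun hR => by
  obtain ⟨μ, C, _, hS⟩ := hR osReconstruction_factField
  exact not_sandwichBound_factField μ C hS

/-! ## §6 The convexity barrier -/

/-- **The convex part of the model-blind core of Σ**: `SandwichModelBlind` with the two non-convex clauses — E4
(clustering, inside the OS package) and the continuum mass gap — DELETED; every remaining hypothesis is stable under
mixtures of families. -/
def SandwichModelBlindConvex : Prop :=
  ∀ (S₁ : SchwingerFamily E4),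
    S₁.toLabelled.IsNormalized → S₁.toLabelled.IsHermitian → S₁.toLabelled.HasLinearGrowth →
    S₁.toLabelled.IsReflectionPositive → S₁.toLabelled.IsSymmetric →
    Translations S₁ → Hypercubic S₁ → EightFrameRP S₁ → PlanarCone S₁ → SoftKernel S₁ →
      SandwichRows S₁ ∧ ∀ R : E4 ≃ₗᵢ[ℝ] E4, IsQuarterTurnFrame R → SandwichRows (fun n => (S₁ n).comp (linActMulti R))

/-- The full model-blind core is the convex part plus E4 and the gap (so the barrier below concerns exactly those two). -/
theorem sandwichModelBlind_of_convex (h : SandwichModelBlindConvex) : SandwichModelBlind :=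
  fun S₁ hOS hT hH _ h8 hC hK => h S₁ hOS.1 hOS.2.1 hOS.2.2.1 hOS.2.2.2.1 hOS.2.2.2.2.1 hT hH h8 hC hK

/-- **Theorem (CONVEXITY BARRIER).**  The convex part of the model-blind core of Σ is FALSE: the random constant field
`𝔖ₙ = n! ∫` meets every convex clause and violates the rows.  Consequently any model-blind proof of
`CurvatureSandwichBound` must use E4 (clustering) or the continuum mass gap — uniqueness of the vacuum — in an essential
way; no argument built only from mixture-stable inequalities (reflection positivity in the sixteen mirrors, Schwarz,
the planar cone, the soft kernel, E0') can reach the rows. -/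
theorem not_sandwichModelBlindConvex : ¬ SandwichModelBlindConvex := fun h =>
  not_sandwichRows_factField (h factField isNormalized_factField isHermitian_factField hasLinearGrowth_factField
    isReflectionPositive_factField isSymmetric_factField translations_factField hypercubic_factField
    eightFrameRP_factField planarCone_factField softKernel_factField).1

end Summit.QuantumFields.YangMills.Theorems.CurvatureSandwichBound.Negative

end
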